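import Mathlib
import HarnessLib
import Summits.HubbardSuperconductivity.HubbardSuperconductivity.Theorems.KLProgrammeC4aLoopIBPBounds
import Summits.HubbardSuperconductivity.HubbardSuperconductivity.Theorems.KLProgrammeC4aEnvelopeLayerCake

/-!
# Route `KLProgramme` — crux C4a, S3 brick (B4) «(B4)-UMK1», part 2: geometry of a FOLD CELL for the signed first-order law — slope floor and value band
# around the fold point, the envelope's level integral `∫ dy/max(t,|y|) ≤ 2 + 4log⁺(G/t)`, and the outer-window envelope integral `≤ σ⁻¹(2 + 4log⁺(G/t))`

Cell `gate-hubbard-kl`, seat hubbard-kl-k3c3-p3 (g27; row «implicit-function / monotonicity route for μ(n)»).  Located brick for the (C)-closer lane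
hubbard-kl-c4a-1 (stub (C) `stub_twoLeg_curvature` of `KLRegimeEngineV17F2`, stmt-HubbardSuperconductivity-20437), design note HOME/hubbard-kl-k3c3-p3/B4-UMK1-DESIGN.md
§4 (b).  A FOLD CELL is a loop window `[α,β]` containing a critical point `v*` of the partner band `g = ē(e,·)` with `c₂ ≤ g″ ≤ L₂` (`…C4aAbsBubbleFoldSheet`'s floor
and ceiling).  The signed law (part 3) splits it into the CORE `|v − v*| ≤ η` (absolute values) and the two OUTER monotone windows (part 1's IBP); this file supplies:
* §1 `abs_deriv_ge_of_fold` (`c₂|v − v*| ≤ |g′ v|`), `abs_deriv_le_of_fold` (`|g′ v| ≤ L₂|v − v*|`), `abs_sub_le_of_fold` (`|g v − g v*| ≤ L₂|v − v*|²`);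
* §2 `intervalIntegral_inv_envelope_id_le` (`∫_{−G..G} dy/max(t,|y|) ≤ 2 + 4log⁺(G/t)`), `abs_intervalIntegral_inv_envelope_le` (between any two levels in `[−G,G]`);
* §3 `intervalIntegral_inv_envelope_comp_le_of_slope` (`σ ≤ |g′|`, `|g| ≤ G` on `[a,b]` ⟹ `∫_{a..b} dv/max(t,|g v|) ≤ σ⁻¹(2 + 4log⁺(G/t))` — `…LoopIBPBounds`' monotone
  substitution + §2).
Pure real analysis; nothing about the Hubbard model.  References: Salmhofer 1999 §4.5.3 [cite: Salmhofer1999]; FST II CPAM 51 (1998) §3 [cite: FeldmanSalmhoferTrubowitz1998].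
-/

noncomputable section

namespace Summit.HubbardSuperconductivity.HubbardSuperconductivity.Theorems.C4a

set_option linter.dupNamespace false -- summit = problem name (single-conjunct summit), D-0017

open Real Set MeasureTheory intervalIntegral

/-! ## §1 Slope floor, slope ceiling and value band around a fold point -/

section Fold

variable {g : ℝ → ℝ} {α β vs c₂ L₂ : ℝ}

/-- **Slope floor at a fold**: `g ∈ C²`, `g′(v*) = 0`, `c₂ ≤ g″` on `[α,β] ∋ v*` ⟹ `c₂·|v − v*| ≤ |g′(v)|` on `[α,β]`. -/
theorem abs_deriv_ge_of_fold (hg : ContDiff ℝ 2 g) (hvs : vs ∈ Icc α β) (hcrit : deriv g vs = 0) (hc₂ : ∀ v ∈ Icc α β, c₂ ≤ iteratedDeriv 2 g v)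
    {v : ℝ} (hv : v ∈ Icc α β) : c₂ * |v - vs| ≤ |deriv g v| := by
  have hdg : Differentiable ℝ (deriv g) := by
    have h : Differentiable ℝ (iteratedDeriv 1 g) := ContDiff.differentiable_iteratedDeriv 1 hg (by norm_num)
    rwa [iteratedDeriv_one] at h
  have hd2 : ∀ x, deriv (deriv g) x = iteratedDeriv 2 g x := fun x => by
    rw [show iteratedDeriv 2 g = deriv (iteratedDeriv 1 g) from iteratedDeriv_succ, iteratedDeriv_one]
  have hconv : Convex ℝ (Icc α β) := convex_Icc α β
  have hge : ∀ x ∈ interior (Icc α β), c₂ ≤ deriv (deriv g) x := fun x hx => by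
    rw [hd2]; exact hc₂ x (interior_subset hx)
  have hmvt := hconv.mul_sub_le_image_sub_of_le_deriv hdg.continuous.continuousOn (hdg.differentiableOn.mono interior_subset) hge
  rcases le_total vs v with h | h
  · have h1 := hmvt vs hvs v hv h
    rw [hcrit, sub_zero] at h1
    rw [abs_of_nonneg (sub_nonneg.2 h)]
    exact h1.trans (le_abs_self _)
  · have h1 := hmvt v hv vs hvs h
    rw [hcrit, zero_sub] at h1
    rw [abs_of_nonpos (sub_nonpos.2 h)]
    calc c₂ * -(v - vs) = c₂ * (vs - v) := by ring
      _ ≤ -deriv g v := h1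
      _ ≤ |deriv g v| := neg_le_abs _

/-- **Slope ceiling at a fold**: `|g″| ≤ L₂` on `[α,β] ∋ v*`, `g′(v*) = 0` ⟹ `|g′(v)| ≤ L₂·|v − v*|` on `[α,β]`. -/
theorem abs_deriv_le_of_fold (hg : ContDiff ℝ 2 g) (hvs : vs ∈ Icc α β) (hcrit : deriv g vs = 0) (hL₂ : ∀ v ∈ Icc α β, |iteratedDeriv 2 g v| ≤ L₂)
    {v : ℝ} (hv : v ∈ Icc α β) : |deriv g v| ≤ L₂ * |v - vs| := by
  have hdg : Differentiable ℝ (deriv g) := by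
    have h : Differentiable ℝ (iteratedDeriv 1 g) := ContDiff.differentiable_iteratedDeriv 1 hg (by norm_num)
    rwa [iteratedDeriv_one] at h
  have hd2 : ∀ x, deriv (deriv g) x = iteratedDeriv 2 g x := fun x => by
    rw [show iteratedDeriv 2 g = deriv (iteratedDeriv 1 g) from iteratedDeriv_succ, iteratedDeriv_one]
  have hbd : ∀ x ∈ Icc α β, ‖deriv (deriv g) x‖ ≤ L₂ := fun x hx => by rw [Real.norm_eq_abs, hd2]; exact hL₂ x hx
  have h := (convex_Icc α β).norm_image_sub_le_of_norm_deriv_le (fun x _ => hdg.differentiableAt) hbd hvs hv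
  rw [hcrit, sub_zero, Real.norm_eq_abs, Real.norm_eq_abs] at h
  exact h

/-- **Value band at a fold**: `|g(v) − g(v*)| ≤ L₂·|v − v*|²` on `[α,β]`. -/
theorem abs_sub_le_of_fold (hg : ContDiff ℝ 2 g) (hvs : vs ∈ Icc α β) (hcrit : deriv g vs = 0) (hL₂ : ∀ v ∈ Icc α β, |iteratedDeriv 2 g v| ≤ L₂)
    {v : ℝ} (hv : v ∈ Icc α β) : |g v - g vs| ≤ L₂ * |v - vs| ^ 2 := by
  have hgd : Differentiable ℝ g := hg.differentiable two_ne_zero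
  -- on the segment between `v*` and `v` the slope is `≤ L₂·|v − v*|`
  have hseg : ∀ x ∈ uIcc vs v, ‖deriv g x‖ ≤ L₂ * |v - vs| := fun x hx => by
    have hxI : x ∈ Icc α β := by
      rcases le_total vs v with h | h
      · rw [uIcc_of_le h] at hx; exact ⟨hvs.1.trans hx.1, hx.2.trans hv.2⟩
      · rw [uIcc_of_ge h] at hx; exact ⟨hv.1.trans hx.1, hx.2.trans hvs.2⟩
    have h1 := abs_deriv_le_of_fold hg hvs hcrit hL₂ hxI
    have hL₂0 : 0 ≤ L₂ := le_trans (abs_nonneg _) (hL₂ vs hvs)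
    have h2 : |x - vs| ≤ |v - vs| := by
      rcases le_total vs v with h | h
      · rw [uIcc_of_le h] at hx
        rw [abs_of_nonneg (sub_nonneg.2 hx.1), abs_of_nonneg (sub_nonneg.2 h)]; linarith [hx.2]
      · rw [uIcc_of_ge h] at hx
        rw [abs_of_nonpos (sub_nonpos.2 hx.2), abs_of_nonpos (sub_nonpos.2 h)]; linarith [hx.1]
    rw [Real.norm_eq_abs]
    exact h1.trans (mul_le_mul_of_nonneg_left h2 hL₂0)
  have h := (convex_uIcc vs v).norm_image_sub_le_of_norm_deriv_le (fun x _ => hgd.differentiableAt) hseg left_mem_uIcc right_mem_uIcc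
  rw [Real.norm_eq_abs, Real.norm_eq_abs] at h
  calc |g v - g vs| ≤ L₂ * |v - vs| * |v - vs| := h
    _ = L₂ * |v - vs| ^ 2 := by ring

end Fold

/-! ## §2 The envelope's level integral -/

/-- **`∫_{−G..G} dy/max(t,|y|) ≤ 2 + 4·log⁺(G/t)`** (`t, G > 0`): `…C4aEnvelopeLayerCake`'s transversal bound for `g = id` (two cells). -/
theorem intervalIntegral_inv_envelope_id_le {t G : ℝ} (ht : 0 < t) (hG : 0 < G) :
    ∫ y in (-G)..G, (max t |y|)⁻¹ ≤ 2 + 4 * log⁺ (G / t) := by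
  have h := integral_inv_envelope_le_of_dichotomy_one (g := fun y : ℝ => y) (a := -G) (b := G) (κ := 2 * G) (c₁ := 1) (L₁ := 1) (N := 2) (by linarith)
    contDiff_id (by positivity) one_pos one_pos (fun x _ => by simp) (fun x _ _ => by simp) (by push_cast; linarith) ht
  rw [intervalIntegral.integral_of_le (by linarith), ← integral_Icc_eq_integral_Ioc]
  refine h.trans (le_of_eq ?_)
  have e : 2 * G / (2 * t) = G / t := by field_simp
  rw [e]; field_simp; ring

/-- **Between any two levels of `[−G,G]`**: `|∫_{p..q} dy/max(t,|y|)| ≤ 2 + 4·log⁺(G/t)`. -/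
theorem abs_intervalIntegral_inv_envelope_le {t G p q : ℝ} (ht : 0 < t) (hG : 0 < G) (hp : p ∈ Icc (-G) G) (hq : q ∈ Icc (-G) G) :
    |∫ y in p..q, (max t |y|)⁻¹| ≤ 2 + 4 * log⁺ (G / t) := by
  have hcont : Continuous fun y : ℝ => (max t |y|)⁻¹ := continuous_inv_envelope (g := fun y : ℝ => y) continuous_id ht
  have hnn : ∀ y : ℝ, 0 ≤ (max t |y|)⁻¹ := fun y => inv_envelope_nonneg (fun y : ℝ => y) ht y
  -- reduce to `p ≤ q`
  wlog hpq : p ≤ q generalizing p q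
  · have h := this hq hp (le_of_not_ge hpq)
    rwa [intervalIntegral.integral_symm, abs_neg] at h
  rw [abs_of_nonneg (intervalIntegral.integral_nonneg hpq fun y _ => hnn y)]
  calc ∫ y in p..q, (max t |y|)⁻¹ ≤ ∫ y in (-G)..G, (max t |y|)⁻¹ :=
        intervalIntegral.integral_mono_interval hp.1 hpq hq.2 (Filter.Eventually.of_forall hnn) (hcont.intervalIntegrable _ _)
    _ ≤ 2 + 4 * log⁺ (G / t) := intervalIntegral_inv_envelope_id_le ht hG

/-! ## §3 The envelope integral over a monotone window -/

/-- **OUTER-WINDOW ENVELOPE INTEGRAL**: `g ∈ C¹`, `σ ≤ |g′|` and `|g| ≤ G` on `[a,b]` (`σ, t, G > 0`) ⟹ `∫_{a..b} dv/max(t,|g v|) ≤ σ⁻¹·(2 + 4log⁺(G/t))`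
(monotone substitution to the level + §2). -/
theorem intervalIntegral_inv_envelope_comp_le_of_slope {g : ℝ → ℝ} {a b σ t G : ℝ} (hab : a ≤ b) (hg : ContDiff ℝ 1 g) (hσ : 0 < σ)
    (hgσ : ∀ v ∈ Icc a b, σ ≤ |deriv g v|) (ht : 0 < t) (hG : 0 < G) (hgG : ∀ v ∈ Icc a b, |g v| ≤ G) :
    ∫ v in a..b, (max t |g v|)⁻¹ ≤ σ⁻¹ * (2 + 4 * log⁺ (G / t)) := by
  have hcont : Continuous fun y : ℝ => (max t |y|)⁻¹ := continuous_inv_envelope (g := fun y : ℝ => y) continuous_id ht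
  have hnn : ∀ y : ℝ, 0 ≤ (max t |y|)⁻¹ := fun y => inv_envelope_nonneg (fun y : ℝ => y) ht y
  have h := intervalIntegral_comp_le_of_abs_deriv_ge (u := fun y : ℝ => (max t |y|)⁻¹) hab hg hσ hgσ hcont hnn
  refine h.trans (mul_le_mul_of_nonneg_left ?_ (inv_nonneg.2 hσ.le))
  have ha : g a ∈ Icc (-G) G := abs_le.1 (hgG a (left_mem_Icc.2 hab))
  have hb : g b ∈ Icc (-G) G := abs_le.1 (hgG b (right_mem_Icc.2 hab))
  exact abs_intervalIntegral_inv_envelope_le ht hG ha hb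

end Summit.HubbardSuperconductivity.HubbardSuperconductivity.Theorems.C4a

end
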